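import Literature.AlgebraicGeometry.Motives.LinearSubspaceSectionsRatEquiv
import Literature.AlgebraicGeometry.Motives.RationalPointsOnLinearSubspace
import Literature.AlgebraicGeometry.Motives.RuledSurfaceRelation
import HarnessLib

/-!
# The plane-family relation: two lines of a plane of the generic fibre differ by vertical planes

The "ruled surface" relation of Tian–Zong (*One-cycles on rationally connected varieties*,
Compositio Math. 150 (2014), proofs of Prop. 3.1 / 7.2; `Motives/RuledSurfaceRelation`:
two points of a line of the generic fibre of `X ×ₖ B → B` differ, in `Rat₁(X ×ₖ B)`, by vertical
components which are lines) ONE DIMENSION UP, as needed by the product-trick argument for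
`2`-cycles (families of lines over a curve are rationally equivalent to sums of planes): for a smooth
curve `B`, `K = k(B)`, a `K`-PLANE `Λ = V₊(μ₁, …, μ_{N-2})` of the generic fibre `X_K ⊆ ℙᴺ_K` and two
`K`-LINES `V₊(μ, ℓ)`, `V₊(μ, ℓ')` in it, there is a generator `c'` of `Rat₂(X ×ₖ B)` (`[div_S ḡ]`,
`S` the closure of `Λ`, a threefold fibred in planes over `B`, `ḡ` the spread of `ℓ/ℓ'`) with
`c' = [closure of the first line] - [closure of the second] + vert`, every point `z` with
`vert z ≠ 0` being a point of dimension `2` over a CLOSED point of `B` whose projection to `X` is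
(the generic point of) a PLANE of `ℙᴺ_k`.

* `exists_eq_ord_of_mem_ratTrivial_of_height` — on an integral `Y` whose generic point has
  dimension `d + 1`, every cycle of `Rat_d(Y)` is ONE principal divisor `[div g]` (the case `d = 0`
  is `exists_eq_ord_of_mem_ratTrivial_zero` of `Motives/RationalPointsOnLinearSubspace`);
* `exists_eq_ord_sub_primeCycle_of_range_eq_plane` — **two lines of a plane `Λ ⊆ ℙᴺ_K` differ by a
  principal divisor ON `Λ`**: `[V₊(μ,ℓ)] - [V₊(μ,ℓ')] = [div_Λ g]` (both are hyperplane sections of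
  `Λ`, `ProjSpace.ofPoint_eq_ofPoint_of_sections` of `Motives/LinearSubspaceSectionsRatEquiv`, and
  `Rat₁` of the surface `Λ` is principal);
* `ProjFamily.exists_plane_of_vertical` — **limits of planes are planes** (the valuative criterion
  for the Grassmannian in coordinates, verbatim the argument of
  `ProjFamily.exists_line_of_vertical`, `Motives/VerticalLimitsOfLines`, for `N - 2` forms);
* `ProjFamily.exists_relation_of_two_lines_on_plane` — the relation in `Rat₂(X ×ₖ B)`.

Everything is proved; no definitions, no named facts.

## References

* [TianZong2014] Z. Tian, H. R. Zong, *One-cycles on rationally connected varieties*, Compositio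
  Math. 150 (2014), proofs of Prop. 3.1 and Prop. 7.2.
* [Fulton1998] W. Fulton, *Intersection Theory*, §1.3, §10.1, Example 2.5.1.
* [Mboro2018] R. Mboro, *Remarks on the CH₂ of cubic hypersurfaces*, arXiv:1701.04488, Thm. 2.8
  and Cor. 2.9 (the role of families of lines in `CH₂`).
-/

noncomputable section

open CategoryTheory CategoryTheory.Limits AlgebraicGeometry MonoidalCategory MvPolynomial
  TopologicalSpace Order

universe u

namespace Literature.AlgebraicGeometry.Motives

/-! ### `Rat_d` of an integral scheme of dimension `d + 1` consists of principal divisors -/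

section RatTop

variable {Y : Scheme.{u}} [IsIntegral Y]

/-- On an irreducible scheme whose generic point has dimension `d`, the generic point is the only
point of dimension `d`. [folklore] -/
theorem eq_genericPoint_of_height_eq {d : ℕ} (hY : height (genericPoint Y) = d) {y : Y}
    (hy : height y = d) : y = genericPoint Y := by
  by_contra hne
  have hle : y ≤ genericPoint Y :=
    Scheme.le_iff_specializes.mpr (genericPoint_specializes y)
  have hlt : y < genericPoint Y := lt_of_le_not_ge hle fun hge =>
    hne ((Scheme.le_iff_specializes.mp hge).antisymm (genericPoint_specializes y)).eq
  have h := height_strictMono hlt (by rw [hy]; exact ENat.coe_lt_top d)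
  rw [hy, hY] at h
  exact lt_irrefl _ h

/-- A closed subvariety of dimension `d` of an integral scheme whose generic point has dimension `d`
is everything: its closed immersion is an isomorphism. [folklore] -/
theorem ClosedSubvariety.isIso_ι_of_dim_eq {d : ℕ} (hY : height (_root_.genericPoint Y) = d)
    (W : ClosedSubvariety Y) (hW : W.dim = d) : IsIso W.ι := by
  have hgen : W.genericPoint = _root_.genericPoint Y :=
    eq_genericPoint_of_height_eq hY (by exact_mod_cast hW)
  have hrange : Set.range W.ι.base = Set.range (𝟙 Y : Y ⟶ Y).base := by
    rw [Scheme.Hom.id_base, TopCat.coe_id, Set.range_id]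
    refine Set.eq_univ_of_univ_subset ?_
    have hcl : closure {_root_.genericPoint Y} ⊆ Set.range W.ι.base := by
      rw [IsClosed.closure_subset_iff W.ι.isClosedEmbedding.isClosed_range, Set.singleton_subset_iff,
        ← hgen]
      exact ⟨_, rfl⟩
    rwa [genericPoint_closure] at hcl
  obtain ⟨e, he⟩ := exists_iso_of_isClosedImmersion_of_range_eq (𝟙 Y) W.ι hrange.symm
  rw [Category.comp_id] at he
  rw [← he]
  infer_instance

variable [IsLocallyNoetherian Y]

/-- **On an integral scheme of dimension `d + 1`, every cycle of `Rat_d` is a principal divisor**: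
if the generic point of `Y` has dimension `d + 1`, each `c ∈ Rat_d(Y)` is `[div g]`,
`c(y) = ord_y(g)`, for one `g ∈ K(Y)ˣ` (the generators are divisors of functions on closed
subvarieties of dimension `d + 1`, i.e. on `Y` itself; `div` is a homomorphism). The case `d = 0` is
`exists_eq_ord_of_mem_ratTrivial_zero`. [cite: Fulton1998, §1.3] -/
theorem exists_eq_ord_of_mem_ratTrivial_of_height {d : ℕ}
    (hY : height (genericPoint Y) = (d + 1 : ℕ)) {c : AlgebraicCycle Y ℤ}
    (hc : c ∈ ratTrivial Y d) : ∃ g : Y.functionField, g ≠ 0 ∧ ∀ y, c y = Scheme.ord g y := by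
  induction hc using AddSubgroup.closure_induction with
  | mem c hc =>
    obtain ⟨-, W, hWn, f, hf, hWdim, hcf⟩ := hc
    haveI := hWn
    have hdim : W.dim = (d + 1 : ℕ) := by rw [hWdim]; norm_cast
    haveI : IsIso W.ι := W.isIso_ι_of_dim_eq hY hdim
    haveI : IsDominant W.ι := inferInstance
    obtain ⟨g, rfl⟩ := (functionFieldMap_bijective_of_flat_of_isPreimmersion W.ι).2 f
    have hg : g ≠ 0 := by
      rintro rfl
      exact hf (map_zero _)
    refine ⟨g, hg, fun y => ?_⟩
    obtain ⟨w, rfl⟩ : ∃ w, W.ι.base w = y := W.ι.surjective y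
    rw [hcf, W.divFun_ι_base, ord_functionFieldMap_of_flat_of_isPreimmersion]
  | zero =>
    refine ⟨1, one_ne_zero, fun y => ?_⟩
    have h := Scheme.ord_mul (x := y) (one_ne_zero (α := Y.functionField)) one_ne_zero
    rw [one_mul] at h
    change (0 : ℤ) = Scheme.ord 1 y
    omega
  | add c c' _ _ hc hc' =>
    obtain ⟨g, hg, hcg⟩ := hc
    obtain ⟨g', hg', hcg'⟩ := hc'
    refine ⟨g * g', mul_ne_zero hg hg', fun y => ?_⟩
    rw [Function.locallyFinsuppWithin.coe_add, Pi.add_apply, hcg, hcg', Scheme.ord_mul hg hg']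
  | neg c _ hc =>
    obtain ⟨g, hg, hcg⟩ := hc
    refine ⟨g⁻¹, inv_ne_zero hg, fun y => ?_⟩
    have h := Scheme.ord_mul (x := y) hg (inv_ne_zero hg)
    rw [mul_inv_cancel₀ hg] at h
    have h1 : Scheme.ord (1 : Y.functionField) y = 0 := by
      have h' := Scheme.ord_mul (x := y) (one_ne_zero (α := Y.functionField)) one_ne_zero
      rw [one_mul] at h'
      omega
    rw [Function.locallyFinsuppWithin.coe_neg, Pi.neg_apply, hcg]
    omega

end RatTop

/-! ### Two lines of a plane differ by a principal divisor on the plane -/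

section PlaneLines

open ProjSpace Literature.AlgebraicGeometry.Motives.Segre

attribute [local instance] MvPolynomial.gradedAlgebra

variable {N : ℕ} {K : Type u} [Field K] [Infinite K]

/-- **Two lines of a plane `Λ ⊆ ℙᴺ_K` differ by ONE principal divisor on `Λ`.** Let `Y` be
integral with a closed immersion `e : Y ↪ ℙᴺ_K` whose image is the plane `V₊(μ₁, …, μ_{N-2})`
(`μ` independent linear forms), and `u, v ∈ Y` the points over the lines `V₊(μ, ℓ)`, `V₊(μ, ℓ')`
(`(μ, ℓ)` and `(μ, ℓ')` independent). Then `[u] - [v] = [div g]` for some `g ∈ K(Y)ˣ`: both are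
hyperplane sections of `Λ` (`ProjSpace.ofPoint_eq_ofPoint_of_sections`; Fulton, Example 2.5.1),
hence rationally equivalent on `Y`, and `Rat₁` of the surface `Y` is principal
(`exists_eq_ord_of_mem_ratTrivial_of_height`). [cite: Fulton1998, Example 2.5.1 and §1.3] -/
theorem exists_eq_ord_sub_primeCycle_of_range_eq_plane (hN : 2 ≤ N)
    (μ : Fin (N - 2) → MvPolynomial (Fin (N + 1)) K) (hμli : LinearIndependent K μ)
    (hμhom : ∀ a, (μ a).IsHomogeneous 1) {Y : Scheme.{u}} [IsIntegral Y]
    (e : Y ⟶ (projectiveSpace N K).left) [IsClosedImmersion e]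
    [LocallyOfFiniteType (e ≫ (projectiveSpace N K).hom)] [IsLocallyNoetherian Y]
    (hrange : Set.range e.base =
      ProjectiveSpectrum.zeroLocus (MvPolynomial.homogeneousSubmodule (Fin (N + 1)) K) (Set.range μ))
    {ℓ ℓ' : MvPolynomial (Fin (N + 1)) K} (hℓ : ℓ.IsHomogeneous 1) (hℓ' : ℓ'.IsHomogeneous 1)
    (hind : LinearIndependent K (Fin.snoc μ ℓ : Fin (N - 2 + 1) → MvPolynomial (Fin (N + 1)) K))
    (hind' : LinearIndependent K (Fin.snoc μ ℓ' : Fin (N - 2 + 1) → MvPolynomial (Fin (N + 1)) K))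
    {u v : Y}
    (hu : (ProjectiveSpectrum.asHomogeneousIdeal
      (𝒜 := MvPolynomial.homogeneousSubmodule (Fin (N + 1)) K) (e.base u)).toIdeal =
        Ideal.span (Set.range (Fin.snoc μ ℓ : Fin (N - 2 + 1) → MvPolynomial (Fin (N + 1)) K)))
    (hv : (ProjectiveSpectrum.asHomogeneousIdeal
      (𝒜 := MvPolynomial.homogeneousSubmodule (Fin (N + 1)) K) (e.base v)).toIdeal =
        Ideal.span (Set.range (Fin.snoc μ ℓ' : Fin (N - 2 + 1) → MvPolynomial (Fin (N + 1)) K))) :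
    ∃ g : Y.functionField, g ≠ 0 ∧ ∀ y, (primeCycle u - primeCycle v) y = Scheme.ord g y := by
  -- `Y` as a `K`-scheme embedded by `e`
  let X' : SchemeOver K := Over.mk (e ≫ (projectiveSpace N K).hom)
  let j : X' ⟶ projectiveSpace N K := Over.homMk e rfl
  haveI : IsIntegral X'.left := ‹IsIntegral Y›
  haveI : LocallyOfFiniteType X'.hom := ‹LocallyOfFiniteType (e ≫ (projectiveSpace N K).hom)›
  haveI : IsClosedImmersion j.left := ‹IsClosedImmersion e›
  have hjl : j.left = e := rfl
  -- heights: the generic point of `Y` is the plane, `u`, `v` are lines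
  have ht : N - 2 ≤ N := Nat.sub_le N 2
  have hgen : e.base (genericPoint Y) = linearSubspacePoint μ hμli hμhom ht := by
    apply eq_linearSubspacePoint_of_closure_eq
    rw [← Set.image_singleton, e.isClosedEmbedding.closure_image_eq, genericPoint_closure,
      Set.image_univ, hrange]
  have hYh : height (genericPoint Y) = ((1 + 1 : ℕ) : ℕ∞) := by
    rw [← height_base_eq_of_isClosedImmersion' e (genericPoint Y), hgen, height_linearSubspacePoint]
    congr 1
    omega
  have hgenj : j.left.base (genericPoint Y) = linearSubspacePoint μ hμli hμhom ht := hgen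
  have hμX : (ProjectiveSpectrum.asHomogeneousIdeal
      (𝒜 := MvPolynomial.homogeneousSubmodule (Fin (N + 1)) K) (j.left.base (genericPoint Y))).toIdeal =
        Ideal.span (Set.range μ) := by
    rw [hgenj, toIdeal_linearSubspacePoint]
  have hs1 : N - 2 + 1 ≤ N := by omega
  have hu_pt : e.base u = linearSubspacePoint (Fin.snoc μ ℓ) hind
      (fun a => by
        refine Fin.lastCases ?_ (fun b => ?_) a
        · rw [Fin.snoc_last]; exact hℓ
        · rw [Fin.snoc_castSucc]; exact hμhom b) hs1 := by
    apply ProjectiveSpectrum.ext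
    apply HomogeneousIdeal.ext
    rw [hu, toIdeal_linearSubspacePoint]
  have hv_pt : e.base v = linearSubspacePoint (Fin.snoc μ ℓ') hind'
      (fun a => by
        refine Fin.lastCases ?_ (fun b => ?_) a
        · rw [Fin.snoc_last]; exact hℓ'
        · rw [Fin.snoc_castSucc]; exact hμhom b) hs1 := by
    apply ProjectiveSpectrum.ext
    apply HomogeneousIdeal.ext
    rw [hv, toIdeal_linearSubspacePoint]
  have huh : height u = 1 := by
    rw [← height_base_eq_of_isClosedImmersion' e u, hu_pt, height_linearSubspacePoint]
    have : N - (N - 2 + 1) = 1 := by omega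
    rw [this, Nat.cast_one]
  have hvh : height v = 1 := by
    rw [← height_base_eq_of_isClosedImmersion' e v, hv_pt, height_linearSubspacePoint]
    have : N - (N - 2 + 1) = 1 := by omega
    rw [this, Nat.cast_one]
  -- the hyperplanes `V₊(ℓ)`, `V₊(ℓ')` do not contain the plane (else `u`, `v` would be the plane)
  have hℓg : ℓ ∈ grading (Fin (N + 1)) K 1 := (MvPolynomial.mem_homogeneousSubmodule 1 ℓ).2 hℓ
  have hℓ'g : ℓ' ∈ grading (Fin (N + 1)) K 1 := (MvPolynomial.mem_homogeneousSubmodule 1 ℓ').2 hℓ'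
  have hℓ0 : ℓ ≠ 0 := hind.ne_zero (Fin.last _) ∘ fun h => by rw [Fin.snoc_last]; exact h
  have hℓ'0 : ℓ' ≠ 0 := hind'.ne_zero (Fin.last _) ∘ fun h => by rw [Fin.snoc_last]; exact h
  have havoid : ∀ {m : MvPolynomial (Fin (N + 1)) K} (hmg : m ∈ grading (Fin (N + 1)) K 1)
      (hm0 : m ≠ 0) {w : Y},
      (ProjectiveSpectrum.asHomogeneousIdeal
        (𝒜 := MvPolynomial.homogeneousSubmodule (Fin (N + 1)) K) (e.base w)).toIdeal =
          Ideal.span (Set.range (Fin.snoc μ m : Fin (N - 2 + 1) → MvPolynomial (Fin (N + 1)) K)) →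
      height w = 1 → (formDivisor m hmg hm0).Avoids (j.left.base (genericPoint Y)) := by
    intro m hmg hm0 w hw hwh
    rw [formDivisor_avoids_iff hmg hm0 one_pos, hgenj]
    intro hmem
    -- then `𝔭(e w) = (μ, m) = (μ)`, so `e w` is the plane: wrong height
    have hmem' : m ∈ Ideal.span (Set.range μ) := by
      have h := (HomogeneousIdeal.mem_iff).2 hmem
      rwa [toIdeal_linearSubspacePoint] at h
    have heq : Ideal.span (Set.range (Fin.snoc μ m : Fin (N - 2 + 1) → MvPolynomial (Fin (N + 1)) K)) =
        Ideal.span (Set.range μ) := by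
      rw [Fin.range_snoc, Ideal.span_insert, sup_eq_right]
      exact (Ideal.span_singleton_le_iff_mem _).2 hmem'
    have hwpt : e.base w = linearSubspacePoint μ hμli hμhom ht := by
      apply ProjectiveSpectrum.ext
      apply HomogeneousIdeal.ext
      rw [hw, heq, toIdeal_linearSubspacePoint]
    have hwh' : height w = ((N - (N - 2) : ℕ) : ℕ∞) := by
      rw [← height_base_eq_of_isClosedImmersion' e w, hwpt, height_linearSubspacePoint]
    rw [hwh] at hwh'
    have : (1 : ℕ) = N - (N - 2) := by exact_mod_cast hwh'
    omega
  -- `[u] = [v]` in `CH₁(Y)`: both are hyperplane sections of the plane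
  have hCH := ofPoint_eq_ofPoint_of_sections j μ
    (fun a => (MvPolynomial.mem_homogeneousSubmodule 1 _).2 (hμhom a)) hs1 hℓg hℓ'g hind hind' hℓ0 hℓ'0
    (havoid hℓg hℓ0 hu huh) (havoid hℓ'g hℓ'0 hv hvh) (s := 1) hYh huh hvh hμX hu hv
  have hrat : primeCycle u - primeCycle v ∈ ratTrivial Y 1 :=
    ChowGroup.isRationallyEquivalent_of_ofPoint_eq huh hvh hCH
  exact exists_eq_ord_of_mem_ratTrivial_of_height (d := 1) hYh hrat

end PlaneLines

/-! ### Limits of linear subspaces are linear subspaces -/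

namespace ProjFamily

open ProjBaseChangeRing ProjectiveSpaceCells
open UniversalHyperplaneSection (sectionsAlgebra fromSpec_comp_hom algebraMap_sections)

attribute [local instance] MvPolynomial.gradedAlgebra MvPolynomial.algebraMvPolynomial
  Literature.AlgebraicGeometry.Motives.ProjBaseChange.algebraBase
  UniversalHyperplaneSection.sectionsAlgebra functionFieldAlgebra

variable {k : Type u} [Field k]

/-- **Specialisations of a linear subspace of the generic fibre satisfy the reduced equations — core
form** of `exists_forms_of_vertical_of_integralForms` below: the hypothesis on the integral vectors
`wvᵢ` is stated directly as "the linear form with coefficients `wvᵢ`, read in `K`, lies in the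
homogeneous prime of `λ'`" (no auxiliary forms `μ`). [cite: TianZong2014, proofs of Prop. 3.1 and Prop. 7.2]
[cite: Fulton1998, §10.1] -/
theorem exists_forms_of_vertical_of_mem [IsAlgClosed k] {N r : ℕ} (B : SchemeOver k)
    [IsIntegral B.left] [LocallyOfFiniteType B.hom]
    (ι : Proj (homogeneousSubmodule (Fin (N + 1)) B.left.functionField) ⟶
      ((projectiveSpace N k) ⊗ B).left)
    (h₁ : ι ≫ (CartesianMonoidalCategory.fst (projectiveSpace N k) B).left =
      Proj.map (mapGraded k B.left.functionField (Fin (N + 1)))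
        (irrelevant_le_map k B.left.functionField (Fin (N + 1))))
    (h₂ : ι ≫ (CartesianMonoidalCategory.snd (projectiveSpace N k) B).left =
      projToSpec (Fin (N + 1)) B.left.functionField ≫ B.left.fromSpecStalk (genericPoint B.left))
    (lam : ↥(Proj (homogeneousSubmodule (Fin (N + 1)) B.left.functionField)))
    {w : ↥((projectiveSpace N k) ⊗ B).left} (hw : w ∈ closure {ι.base lam})
    {b : B.left} (hb : IsClosed ({b} : Set B.left))
    (hwb : (CartesianMonoidalCategory.snd (projectiveSpace N k) B).left.base w = b)
    (wv : Fin r → Fin (N + 1) → B.left.presheaf.stalk b)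
    (hwmem : ∀ i, lin (Literature.LinearAlgebra.toFrac (B.left.presheaf.stalk b)
      B.left.functionField (wv i)) ∈
      ProjectiveSpectrum.asHomogeneousIdeal (𝒜 := homogeneousSubmodule (Fin (N + 1)) B.left.functionField) lam)
    (hliO : LinearIndependent (IsLocalRing.ResidueField (B.left.presheaf.stalk b))
      fun i j => IsLocalRing.residue _ (wv i j)) :
    ∃ L : Fin r → MvPolynomial (Fin (N + 1)) k, LinearIndependent k L ∧
      (∀ l, (L l).IsHomogeneous 1) ∧
        (CartesianMonoidalCategory.fst (projectiveSpace N k) B).left.base w ∈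
          ProjectiveSpectrum.zeroLocus (homogeneousSubmodule (Fin (N + 1)) k) (Set.range L) ∧
        height ((CartesianMonoidalCategory.fst (projectiveSpace N k) B).left.base w) = height w := by
  classical
  -- an affine neighbourhood `U = Spec A` of `b`
  obtain ⟨_, ⟨U, hU, rfl⟩, hbU, -⟩ :=
    B.left.isBasis_affineOpens.exists_subset_of_mem_open (Set.mem_univ b) isOpen_univ
  haveI : Nonempty U := ⟨⟨b, hbU⟩⟩
  haveI := isScalarTower_sections_functionField B U
  -- the local ring at `b`, a PID with fraction field `B.left.functionField`, a localization of `A`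
  obtain ⟨x, hx⟩ : ∃ x : U, (x : B.left) = b := ⟨⟨b, hbU⟩, rfl⟩
  subst hx
  haveI hloc : IsLocalization.AtPrime (B.left.presheaf.stalk (x : B.left)) (hU.primeIdealOf x).asIdeal :=
    hU.isLocalization_stalk x
  haveI : IsScalarTower Γ(B.left, U) (B.left.presheaf.stalk (x : B.left)) B.left.functionField :=
    functionField_isScalarTower B.left U x
  -- evaluation at `b`, the `A`-algebra structure on `k`, its kernel
  letI algk : Algebra Γ(B.left, U) k := (ev B hb hbU).toAlgebra
  have hret : ∀ c : k, algebraMap Γ(B.left, U) k (algebraMap k Γ(B.left, U) c) = c :=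
    ev_scalarRingHom B hb hbU
  have hsurj : Function.Surjective (algebraMap Γ(B.left, U) k) := ev_surjective B hb hbU
  have hrange : Set.range (pt B hU).base = {(x : B.left)} := range_pt_eq B hU hb hbU
  have hker : RingHom.ker (algebraMap Γ(B.left, U) k) = (hU.primeIdealOf x).asIdeal :=
    ker_ev_eq_primeIdealOf B hU hb hbU
  -- Step 3: clear denominators: a common `t ∉ 𝔭_b` with `t • wv i j` integral over `A`
  obtain ⟨t, ht⟩ := IsLocalization.exist_integer_multiples (hU.primeIdealOf x).asIdeal.primeCompl
    (Finset.univ : Finset (Fin r × Fin (N + 1))) (fun q => wv q.1 q.2)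
  choose! y hy using ht
  -- `y i j ∈ A` with `y i j = t • wv i j` in `𝒪_{B,b}`
  have hy' : ∀ i j, algebraMap Γ(B.left, U) (B.left.presheaf.stalk (x : B.left)) (y (i, j)) =
      algebraMap Γ(B.left, U) (B.left.presheaf.stalk (x : B.left)) t * wv i j := fun i j => by
    rw [hy (i, j) (Finset.mem_univ _), Algebra.smul_def]
  -- the forms over `A`
  let μA : Fin r → MvPolynomial (Fin (N + 1)) Γ(B.left, U) := fun i => linR fun j => y (i, j)
  -- Step 4: the forms over `A` vanish at `λ'` after scalar extension to `B.left.functionField`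
  have hμAK : ∀ i, MvPolynomial.map (algebraMap Γ(B.left, U) B.left.functionField) (μA i) ∈
      ProjectiveSpectrum.asHomogeneousIdeal (𝒜 := homogeneousSubmodule (Fin (N + 1)) B.left.functionField) lam := by
    intro i
    rw [map_linR]
    have hcoef : (fun j => algebraMap Γ(B.left, U) B.left.functionField (y (i, j))) =
        fun j => algebraMap Γ(B.left, U) B.left.functionField t *
          Literature.LinearAlgebra.toFrac (B.left.presheaf.stalk (x : B.left)) B.left.functionField (wv i) j := by
      funext j
      rw [Literature.LinearAlgebra.toFrac_apply, IsScalarTower.algebraMap_apply Γ(B.left, U)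
        (B.left.presheaf.stalk (x : B.left)) B.left.functionField, hy' i j, map_mul, ← IsScalarTower.algebraMap_apply]
    rw [hcoef]
    have hsmul : lin (fun j => algebraMap Γ(B.left, U) B.left.functionField t *
        Literature.LinearAlgebra.toFrac (B.left.presheaf.stalk (x : B.left)) B.left.functionField (wv i) j) =
        C (algebraMap Γ(B.left, U) B.left.functionField t) *
          lin (Literature.LinearAlgebra.toFrac (B.left.presheaf.stalk (x : B.left)) B.left.functionField (wv i)) := by
      simp only [lin, Finset.mul_sum, MvPolynomial.smul_eq_C_mul, map_mul, mul_assoc]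
    rw [hsmul]
    exact Ideal.mul_mem_left _ _ (hwmem i)
  -- Step 5: specialise to the fibre over `b`
  have hw' : w ∈ closure {(openPiece N B hU).base ((Proj.map (mapGraded Γ(B.left, U) B.left.functionField (Fin (N + 1)))
      (irrelevant_le_map Γ(B.left, U) B.left.functionField (Fin (N + 1)))).base lam)} := by
    have hι := eq_map_comp_openPiece N B hU ι h₁ (h₂.trans (by
      rw [fromSpecStalk_genericPoint_eq B hU]))
    rw [hι, Scheme.Hom.comp_base, TopCat.coe_comp, Function.comp_apply] at hw
    exact hw
  have hbmem : (CartesianMonoidalCategory.snd (projectiveSpace N k) B).left.base w ∈ Set.range (pt B hU).base := by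
    rw [hrange, hwb]
    exact Set.mem_singleton _
  have hvan : ∀ i, MvPolynomial.map (algebraMap Γ(B.left, U) k) (μA i) ∈
      ProjectiveSpectrum.asHomogeneousIdeal (𝒜 := homogeneousSubmodule (Fin (N + 1)) k) ((CartesianMonoidalCategory.fst (projectiveSpace N k) B).left.base w) :=
    fun i => map_mem_asHomogeneousIdeal_of_mem_closure N B hU hret lam hbmem hw' (hμAK i)
  -- Step 6: the reduced forms and their independence
  let L : Fin r → MvPolynomial (Fin (N + 1)) k := fun i => lin fun j => algebraMap Γ(B.left, U) k (y (i, j))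
  have hLeq : ∀ i, MvPolynomial.map (algebraMap Γ(B.left, U) k) (μA i) = L i := fun i => map_linR _ _
  have hLhom : ∀ i, (L i).IsHomogeneous 1 := fun i => isHomogeneous_lin _
  -- the residue isomorphisms `A/𝔭 ≃ k` (evaluation) and `A/𝔭 ≃ κ(𝒪)` (localization)
  have h𝔭max : (hU.primeIdealOf x).asIdeal.IsMaximal :=
    hker ▸ RingHom.ker_isMaximal_of_surjective _ hsurj
  haveI := h𝔭max
  let ψ₀ : Γ(B.left, U) ⧸ (hU.primeIdealOf x).asIdeal ≃+* k :=
    (Ideal.quotEquivOfEq hker.symm).trans (RingHom.quotientKerEquivOfSurjective hsurj)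
  have hψ : ∀ a : Γ(B.left, U), ψ₀ (Ideal.Quotient.mk _ a) = algebraMap Γ(B.left, U) k a := by
    intro a
    change RingHom.quotientKerEquivOfSurjective hsurj (Ideal.quotEquivOfEq hker.symm (Ideal.Quotient.mk _ a)) = _
    rw [Ideal.quotEquivOfEq_mk]
    exact RingHom.quotientKerEquivOfSurjective_apply_mk hsurj a
  let θ : Γ(B.left, U) ⧸ (hU.primeIdealOf x).asIdeal ≃+*
      IsLocalRing.ResidueField (B.left.presheaf.stalk (x : B.left)) :=
    IsLocalization.AtPrime.equivQuotMaximalIdeal (hU.primeIdealOf x).asIdeal (B.left.presheaf.stalk (x : B.left))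
  have hθ : ∀ a : Γ(B.left, U), θ (Ideal.Quotient.mk _ a) =
      IsLocalRing.residue _ (algebraMap Γ(B.left, U) (B.left.presheaf.stalk (x : B.left)) a) := fun a => rfl
  let σ : IsLocalRing.ResidueField (B.left.presheaf.stalk (x : B.left)) ≃+* k := θ.symm.trans ψ₀
  -- the reductions of the `wv i` are independent over `κ(𝒪)`, hence (via `σ`) over `k`
  have hlik : LinearIndependent k fun i => σ ∘ fun j => IsLocalRing.residue _ (wv i j) :=
    linearIndependent_comp_ringEquiv σ hliO
  have htk : algebraMap Γ(B.left, U) k t ≠ 0 := by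
    intro h0
    have ht𝔭 : (t : Γ(B.left, U)) ∈ RingHom.ker (algebraMap Γ(B.left, U) k) := h0
    rw [hker] at ht𝔭
    exact t.2 ht𝔭
  have hθt : θ (Ideal.Quotient.mk _ (t : Γ(B.left, U))) ≠ 0 := by
    rw [RingEquiv.map_ne_zero_iff, Ne, Ideal.Quotient.eq_zero_iff_mem]
    exact t.2
  -- `ev (y i j) = ev t * σ (wv i j mod 𝔪𝒪)`
  have hred : ∀ i j, algebraMap Γ(B.left, U) k (y (i, j)) = algebraMap Γ(B.left, U) k t *
      σ (IsLocalRing.residue _ (wv i j)) := by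
    intro i j
    -- in `κ(𝒪)`: `y i j = t * wv i j`
    have h1 : IsLocalRing.residue _ (wv i j) =
        (θ (Ideal.Quotient.mk _ (t : Γ(B.left, U))))⁻¹ * θ (Ideal.Quotient.mk _ (y (i, j))) := by
      rw [hθ, hθ, hy' i j, map_mul, ← mul_assoc, inv_mul_cancel₀ (by rw [← hθ]; exact hθt), one_mul]
    rw [h1, map_mul, map_inv₀]
    change _ = _ * ((ψ₀ (θ.symm (θ _)))⁻¹ * ψ₀ (θ.symm (θ _)))
    rw [RingEquiv.symm_apply_apply, RingEquiv.symm_apply_apply, hψ, hψ, ← mul_assoc,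
      mul_inv_cancel₀ htk, one_mul]
  have hLli : LinearIndependent k L := by
    have hcoords : LinearIndependent k fun i j => algebraMap Γ(B.left, U) k (y (i, j)) := by
      have h := hlik.units_smul fun _ => Units.mk0 _ htk
      convert h using 1
      funext i j
      simp only [Pi.smul_apply', Units.smul_mk0, Pi.smul_apply, smul_eq_mul, Function.comp_apply]
      exact hred i j
    exact hcoords.map' (linMap (k := k) (N := N)) ker_linMap
  -- Step 7: `((CartesianMonoidalCategory.fst (projectiveSpace N k) B).left.base w)` lies on the line `V₊(L)` and has dimension one, so it is its generic point
  have hpmem : ((CartesianMonoidalCategory.fst (projectiveSpace N k) B).left.base w) ∈ ProjectiveSpectrum.zeroLocus (homogeneousSubmodule (Fin (N + 1)) k) (Set.range L) := by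
    rintro _ ⟨i, rfl⟩
    rw [← hLeq]
    exact hvan i
  have hclosed : IsClosed (Set.range (pt B hU).base) := by rw [hrange]; exact hb
  haveI := isClosedImmersion_slice N B hU hsurj hclosed
  have hwp : w = slice N B hU ((CartesianMonoidalCategory.fst (projectiveSpace N k) B).left.base w) := eq_slice_fst_of_snd_mem N B hU hret hbmem
  refine ⟨L, hLli, hLhom, hpmem, ?_⟩
  rw [← height_base_eq_of_isClosedImmersion' (slice N B hU)
    ((CartesianMonoidalCategory.fst (projectiveSpace N k) B).left.base w), ← hwp]

/-- **Specialisations of a linear subspace of the generic fibre satisfy the reduced equations — core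
statement with given integral forms** (no dimension hypothesis on `w`; also records that the projection
`pr₁` preserves the dimension of points over the closed point `b`). Formerly:
**Limits of linear subspaces are linear subspaces — core statement with given integral forms.**
As `ProjFamily.exists_line_of_vertical` of `Motives/VerticalLimitsOfLines`, for `r ≤ N` forms instead
of `N - 1`, and with the output of the Smith-normal-form step taken as INPUT: vectors `wv i` with
coordinates in the local ring `𝒪_{B,b}` lying in the `K`-span of the coefficient vectors of the `μ l`
and with linearly independent reductions modulo `𝔪_b` (so no hypothesis on `𝒪_{B,b}`; this is the
form used over bases of dimension `2`, where the forms come from a chart of the Grassmannian).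
Original description (the valuative criterion for
the Grassmannian `G(N-t, N)` in coordinates; same proof: Smith normal form over the discrete
valuation ring `𝒪_{B,b}`, clearing denominators, specialisation of forms along the closure, and
the dimension count `height (pr₁ w) = N - t`). Let `k` be algebraically closed, `B` an integral
`k`-scheme locally of finite type, `K = k(B)`, `ι : ℙᴺ_K → ℙᴺ ×ₖ B` the generic fibre, `λ'` a point
of `ℙᴺ_K` at which `t` independent linear forms `μᵢ` over `K` vanish, and `w ∈ ℙᴺ ×ₖ B` a point of
dimension `N - t` in the closure of `ι(λ')` over a closed point `b` with principal local ring. Then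
`closure {pr₁ w} = V₊(L̄₁, …, L̄_t)` for independent linear forms `L̄ᵢ` over `k`: for `t = N - 2`,
**limits of planes are planes**. [cite: TianZong2014, proofs of Prop. 3.1 and Prop. 7.2]
[cite: Fulton1998, §10.1] -/
theorem exists_forms_of_vertical_of_integralForms [IsAlgClosed k] {N r : ℕ} (B : SchemeOver k)
    [IsIntegral B.left] [LocallyOfFiniteType B.hom]
    (ι : Proj (homogeneousSubmodule (Fin (N + 1)) B.left.functionField) ⟶
      ((projectiveSpace N k) ⊗ B).left)
    (h₁ : ι ≫ (CartesianMonoidalCategory.fst (projectiveSpace N k) B).left =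
      Proj.map (mapGraded k B.left.functionField (Fin (N + 1)))
        (irrelevant_le_map k B.left.functionField (Fin (N + 1))))
    (h₂ : ι ≫ (CartesianMonoidalCategory.snd (projectiveSpace N k) B).left =
      projToSpec (Fin (N + 1)) B.left.functionField ≫ B.left.fromSpecStalk (genericPoint B.left))
    (μ : Fin r → MvPolynomial (Fin (N + 1)) B.left.functionField)
    (hμli : LinearIndependent B.left.functionField μ) (hμhom : ∀ l, (μ l).IsHomogeneous 1)
    (lam : ↥(Proj (homogeneousSubmodule (Fin (N + 1)) B.left.functionField)))
    (hlam : ∀ l, μ l ∈ ProjectiveSpectrum.asHomogeneousIdeal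
      (𝒜 := homogeneousSubmodule (Fin (N + 1)) B.left.functionField) lam)
    {w : ↥((projectiveSpace N k) ⊗ B).left} (hw : w ∈ closure {ι.base lam})
    {b : B.left} (hb : IsClosed ({b} : Set B.left))
    (hwb : (CartesianMonoidalCategory.snd (projectiveSpace N k) B).left.base w = b)
    (wv : Fin r → Fin (N + 1) → B.left.presheaf.stalk b)
    (hwv : ∀ i, Literature.LinearAlgebra.toFrac (B.left.presheaf.stalk b) B.left.functionField (wv i) ∈
      Submodule.span B.left.functionField
        (Set.range fun (l : Fin r) (j : Fin (N + 1)) => coeff (Finsupp.single j 1) (μ l)))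
    (hliO : LinearIndependent (IsLocalRing.ResidueField (B.left.presheaf.stalk b))
      fun i j => IsLocalRing.residue _ (wv i j)) :
    ∃ L : Fin r → MvPolynomial (Fin (N + 1)) k, LinearIndependent k L ∧
      (∀ l, (L l).IsHomogeneous 1) ∧
        (CartesianMonoidalCategory.fst (projectiveSpace N k) B).left.base w ∈
          ProjectiveSpectrum.zeroLocus (homogeneousSubmodule (Fin (N + 1)) k) (Set.range L) ∧
        height ((CartesianMonoidalCategory.fst (projectiveSpace N k) B).left.base w) = height w := by
  classical
  -- Step 1: the coefficient vectors of the `μ l` and their span `W`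
  let vμ : Fin r → Fin (N + 1) → B.left.functionField := fun l j => coeff (Finsupp.single j 1) (μ l)
  have hvμ : ∀ l, lin (vμ l) = μ l := fun l => (eq_lin_of_isHomogeneous_one (hμhom l)).symm
  have hvli : LinearIndependent B.left.functionField vμ := by
    refine LinearIndependent.of_comp (linMap (k := B.left.functionField) (N := N)) ?_
    have : ⇑(linMap (k := B.left.functionField) (N := N)) ∘ vμ = μ := funext fun l => hvμ l
    rw [this]
    exact hμli
  let W : Submodule B.left.functionField (Fin (N + 1) → B.left.functionField) := Submodule.span B.left.functionField (Set.range vμ)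
  have hfr : Module.finrank B.left.functionField W = r := by
    rw [finrank_span_eq_card hvli, Fintype.card_fin]
  -- each `wv i` gives a linear form over `B.left.functionField` in the homogeneous prime of `λ'`
  have hwmem : ∀ i, lin (Literature.LinearAlgebra.toFrac (B.left.presheaf.stalk b) B.left.functionField (wv i)) ∈
      ProjectiveSpectrum.asHomogeneousIdeal (𝒜 := homogeneousSubmodule (Fin (N + 1)) B.left.functionField) lam := by
    intro i
    have hin : Literature.LinearAlgebra.toFrac (B.left.presheaf.stalk b) B.left.functionField (wv i) ∈ W := by
      exact hwv i
    let I : Submodule B.left.functionField (MvPolynomial (Fin (N + 1)) B.left.functionField) :=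
      ((ProjectiveSpectrum.asHomogeneousIdeal
        (𝒜 := homogeneousSubmodule (Fin (N + 1)) B.left.functionField) lam).toIdeal).restrictScalars B.left.functionField
    have hle : W ≤ I.comap (linMap (k := B.left.functionField) (N := N)) := by
      refine Submodule.span_le.mpr ?_
      rintro _ ⟨l, rfl⟩
      change lin (vμ l) ∈ (ProjectiveSpectrum.asHomogeneousIdeal
        (𝒜 := homogeneousSubmodule (Fin (N + 1)) B.left.functionField) lam).toIdeal
      rw [hvμ]
      exact hlam l
    exact hle hin
  exact exists_forms_of_vertical_of_mem B ι h₁ h₂ lam hw hb hwb wv hwmem hliO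

/-- **Limits of linear subspaces are linear subspaces** — given integral forms with independent
reductions at the base point `b` (closed), a point `w` of dimension `N - r` over `b` in the closure of
the `r`-codimensional linear subspace of the generic fibre projects to the generic point of an
`(N-r)`-plane `V₊(L̄)` of `ℙᴺ_k` (`exists_forms_of_vertical_of_integralForms` and the dimension
count). [cite: TianZong2014, proofs of Prop. 3.1 and Prop. 7.2] [cite: Fulton1998, §10.1] -/
theorem exists_linearSubspace_of_vertical_of_integralForms [IsAlgClosed k] {N r : ℕ} (hrN : r ≤ N)
    (B : SchemeOver k)
    [IsIntegral B.left] [LocallyOfFiniteType B.hom]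
    (ι : Proj (homogeneousSubmodule (Fin (N + 1)) B.left.functionField) ⟶
      ((projectiveSpace N k) ⊗ B).left)
    (h₁ : ι ≫ (CartesianMonoidalCategory.fst (projectiveSpace N k) B).left =
      Proj.map (mapGraded k B.left.functionField (Fin (N + 1)))
        (irrelevant_le_map k B.left.functionField (Fin (N + 1))))
    (h₂ : ι ≫ (CartesianMonoidalCategory.snd (projectiveSpace N k) B).left =
      projToSpec (Fin (N + 1)) B.left.functionField ≫ B.left.fromSpecStalk (genericPoint B.left))
    (μ : Fin r → MvPolynomial (Fin (N + 1)) B.left.functionField)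
    (hμli : LinearIndependent B.left.functionField μ) (hμhom : ∀ l, (μ l).IsHomogeneous 1)
    (lam : ↥(Proj (homogeneousSubmodule (Fin (N + 1)) B.left.functionField)))
    (hlam : ∀ l, μ l ∈ ProjectiveSpectrum.asHomogeneousIdeal
      (𝒜 := homogeneousSubmodule (Fin (N + 1)) B.left.functionField) lam)
    {w : ↥((projectiveSpace N k) ⊗ B).left} (hw : w ∈ closure {ι.base lam})
    (hheight : height w = ((N - r : ℕ) : ℕ∞)) {b : B.left} (hb : IsClosed ({b} : Set B.left))
    (hwb : (CartesianMonoidalCategory.snd (projectiveSpace N k) B).left.base w = b)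
    (wv : Fin r → Fin (N + 1) → B.left.presheaf.stalk b)
    (hwv : ∀ i, Literature.LinearAlgebra.toFrac (B.left.presheaf.stalk b) B.left.functionField (wv i) ∈
      Submodule.span B.left.functionField
        (Set.range fun (l : Fin r) (j : Fin (N + 1)) => coeff (Finsupp.single j 1) (μ l)))
    (hliO : LinearIndependent (IsLocalRing.ResidueField (B.left.presheaf.stalk b))
      fun i j => IsLocalRing.residue _ (wv i j)) :
    ∃ L : Fin r → MvPolynomial (Fin (N + 1)) k, LinearIndependent k L ∧
      (∀ l, (L l).IsHomogeneous 1) ∧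
        closure {(CartesianMonoidalCategory.fst (projectiveSpace N k) B).left.base w} =
          ProjectiveSpectrum.zeroLocus (homogeneousSubmodule (Fin (N + 1)) k) (Set.range L) := by
  obtain ⟨L, hLli, hLhom, hpmem, hheightp⟩ := exists_forms_of_vertical_of_integralForms B ι h₁ h₂ μ
    hμli hμhom lam hlam hw hb hwb wv hwv hliO
  rw [hheight] at hheightp
  have hpeq : ((CartesianMonoidalCategory.fst (projectiveSpace N k) B).left.base w) =
      linearSubspacePoint L hLli hLhom hrN := by
    by_contra hne
    have hlt := height_lt_of_mem_zeroLocus L hLli hLhom hrN hpmem hne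
    rw [hheightp] at hlt
    exact lt_irrefl _ hlt
  refine ⟨L, hLli, hLhom, ?_⟩
  rw [hpeq, closure_linearSubspacePoint]

/-- **Limits of linear subspaces are linear subspaces** over a base point with principal local ring
(`exists_linearSubspace_of_vertical_of_integralForms` + Smith normal form over the discrete
valuation ring `𝒪_{B,b}`, `Literature.LinearAlgebra.exists_integral_basis_linearIndependent_quotient`):
the statement of `ProjFamily.exists_line_of_vertical` (`Motives/VerticalLimitsOfLines`) for `r ≤ N`
forms. [cite: TianZong2014, proofs of Prop. 3.1 and Prop. 7.2] [cite: Fulton1998, §10.1] -/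
theorem exists_linearSubspace_of_vertical [IsAlgClosed k] {N r : ℕ} (hrN : r ≤ N)
    (B : SchemeOver k)
    [IsIntegral B.left] [LocallyOfFiniteType B.hom]
    (ι : Proj (homogeneousSubmodule (Fin (N + 1)) B.left.functionField) ⟶
      ((projectiveSpace N k) ⊗ B).left)
    (h₁ : ι ≫ (CartesianMonoidalCategory.fst (projectiveSpace N k) B).left =
      Proj.map (mapGraded k B.left.functionField (Fin (N + 1)))
        (irrelevant_le_map k B.left.functionField (Fin (N + 1))))
    (h₂ : ι ≫ (CartesianMonoidalCategory.snd (projectiveSpace N k) B).left =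
      projToSpec (Fin (N + 1)) B.left.functionField ≫ B.left.fromSpecStalk (genericPoint B.left))
    (μ : Fin r → MvPolynomial (Fin (N + 1)) B.left.functionField)
    (hμli : LinearIndependent B.left.functionField μ) (hμhom : ∀ l, (μ l).IsHomogeneous 1)
    (lam : ↥(Proj (homogeneousSubmodule (Fin (N + 1)) B.left.functionField)))
    (hlam : ∀ l, μ l ∈ ProjectiveSpectrum.asHomogeneousIdeal
      (𝒜 := homogeneousSubmodule (Fin (N + 1)) B.left.functionField) lam)
    {w : ↥((projectiveSpace N k) ⊗ B).left} (hw : w ∈ closure {ι.base lam})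
    (hheight : height w = ((N - r : ℕ) : ℕ∞)) {b : B.left} (hb : IsClosed ({b} : Set B.left))
    (hwb : (CartesianMonoidalCategory.snd (projectiveSpace N k) B).left.base w = b)
    (hpid : IsPrincipalIdealRing (B.left.presheaf.stalk b)) :
    ∃ L : Fin r → MvPolynomial (Fin (N + 1)) k, LinearIndependent k L ∧
      (∀ l, (L l).IsHomogeneous 1) ∧
        closure {(CartesianMonoidalCategory.fst (projectiveSpace N k) B).left.base w} =
          ProjectiveSpectrum.zeroLocus (homogeneousSubmodule (Fin (N + 1)) k) (Set.range L) := by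
  classical
  -- the coefficient vectors of the `μ l` and their span `W`
  let vμ : Fin r → Fin (N + 1) → B.left.functionField := fun l j => coeff (Finsupp.single j 1) (μ l)
  have hvμ : ∀ l, lin (vμ l) = μ l := fun l => (eq_lin_of_isHomogeneous_one (hμhom l)).symm
  have hvli : LinearIndependent B.left.functionField vμ := by
    refine LinearIndependent.of_comp (linMap (k := B.left.functionField) (N := N)) ?_
    have : ⇑(linMap (k := B.left.functionField) (N := N)) ∘ vμ = μ := funext fun l => hvμ l
    rw [this]
    exact hμli
  let W : Submodule B.left.functionField (Fin (N + 1) → B.left.functionField) :=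
    Submodule.span B.left.functionField (Set.range vμ)
  have hfr : Module.finrank B.left.functionField W = r := by
    rw [finrank_span_eq_card hvli, Fintype.card_fin]
  -- integral basis with independent reductions (Smith normal form over the PID `𝒪_{B,b}`)
  haveI : IsPrincipalIdealRing (B.left.presheaf.stalk b) := hpid
  obtain ⟨n, wv, hn, -, hspan, hli⟩ :=
    Literature.LinearAlgebra.exists_integral_basis_linearIndependent_quotient
      (O := B.left.presheaf.stalk b) (K := B.left.functionField) W
  have hnN : r = n := (hn.symm.trans hfr).symm
  clear hn
  subst n
  exact exists_linearSubspace_of_vertical_of_integralForms hrN B ι h₁ h₂ μ hμli hμhom lam hlam hw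
    hheight hb hwb wv (fun i => by
      change _ ∈ W
      rw [← hspan]
      exact Submodule.subset_span ⟨i, rfl⟩)
    (hli (IsLocalRing.maximalIdeal (B.left.presheaf.stalk b)))

end ProjFamily

/-! ### The plane-family relation in `Rat₂(X ×ₖ B)` -/

namespace ProjFamily

open ProjBaseChangeRing ProjectiveSpaceCells

attribute [local instance] MvPolynomial.gradedAlgebra MvPolynomial.algebraMvPolynomial
  Literature.AlgebraicGeometry.Motives.ProjBaseChange.algebraBase
  UniversalHyperplaneSection.sectionsAlgebra functionFieldAlgebra

section Relation

variable {k : Type u} [Field k]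
variable [IsAlgClosed k] {N : ℕ} (B : SchemeOver k) [IsIntegral B.left] [LocallyOfFiniteType B.hom]
  (X : SchemeOver k) (i : X ⟶ projectiveSpace N k) [IsClosedImmersion i.left]

/-- **The plane-family relation** (the ruled-surface relation of Tian–Zong one dimension up, for
the closure in `X ×ₖ B` of a PLANE of the generic fibre). Let `k` be algebraically closed,
`X ⊆ ℙᴺ_k` closed, `B` an integral `k`-scheme locally of finite type with generic point of dimension
`1` and principal local rings at its closed points, `K = k(B)`. Let `μ₁, …, μ_{N-2}` be independent
linear forms over `K` whose plane `Λ = V₊(μ) ⊆ ℙᴺ_K` lies in the generic fibre `X_K`, and `ℓ_u, ℓ_v`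
linear forms independent of the `μ_l`, cutting the lines `V₊(μ, ℓ_u), V₊(μ, ℓ_v) ⊆ Λ`. Then there
are `c' ∈ Rat₂(X ×ₖ B)`, lifts `u_X, v_X ∈ X_K` of (the generic points of) the two lines, and a cycle
`vert` with `c' = [ι u_X] - [ι v_X] + vert` (`ι : X_K → X ×ₖ B`) such that every `z` with
`vert z ≠ 0` has dimension `2`, lies over a closed point of `B`, and `i (pr₁ z)` is the generic
point of a PLANE: `closure {i (pr₁ z)} = V₊(L̄)` for `N - 2` independent linear forms `L̄` over `k`.
[cite: TianZong2014, proofs of Prop. 3.1 and Prop. 7.2] [cite: BlochLectures2010, Lemma 1A.1] -/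
theorem exists_relation_of_two_lines_on_plane (hN : 2 ≤ N) (hB1 : height (genericPoint B.left) = 1)
    (hpid : ∀ b : B.left, IsClosed ({b} : Set B.left) →
      IsPrincipalIdealRing (B.left.presheaf.stalk b))
    (μ : Fin (N - 2) → MvPolynomial (Fin (N + 1)) B.left.functionField)
    (hμli : LinearIndependent B.left.functionField μ) (hμhom : ∀ l, (μ l).IsHomogeneous 1)
    (hplane : ProjectiveSpectrum.zeroLocus
      (homogeneousSubmodule (Fin (N + 1)) B.left.functionField) (Set.range μ) ⊆
        Set.range (iK N B X i).base)
    {ℓu ℓv : MvPolynomial (Fin (N + 1)) B.left.functionField} (hℓu : ℓu.IsHomogeneous 1)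
    (hℓv : ℓv.IsHomogeneous 1)
    (hindu : LinearIndependent B.left.functionField
      (Fin.snoc μ ℓu : Fin (N - 2 + 1) → MvPolynomial (Fin (N + 1)) B.left.functionField))
    (hindv : LinearIndependent B.left.functionField
      (Fin.snoc μ ℓv : Fin (N - 2 + 1) → MvPolynomial (Fin (N + 1)) B.left.functionField)) :
    ∃ c' ∈ ratTrivial (X ⊗ B).left 2, ∃ uX vX : ↥(XK B X),
      (ProjectiveSpectrum.asHomogeneousIdeal
        (𝒜 := homogeneousSubmodule (Fin (N + 1)) B.left.functionField) ((iK N B X i).base uX)).toIdeal =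
          Ideal.span (Set.range
            (Fin.snoc μ ℓu : Fin (N - 2 + 1) → MvPolynomial (Fin (N + 1)) B.left.functionField)) ∧
      (ProjectiveSpectrum.asHomogeneousIdeal
        (𝒜 := homogeneousSubmodule (Fin (N + 1)) B.left.functionField) ((iK N B X i).base vX)).toIdeal =
          Ideal.span (Set.range
            (Fin.snoc μ ℓv : Fin (N - 2 + 1) → MvPolynomial (Fin (N + 1)) B.left.functionField)) ∧
      ∃ vert : AlgebraicCycle (X ⊗ B).left ℤ,
        c' = primeCycle ((ιX B X).base uX) - primeCycle ((ιX B X).base vX) + vert ∧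
        ∀ z, vert z ≠ 0 → height z = 2 ∧
          IsClosed ({(CartesianMonoidalCategory.snd X B).left.base z} : Set B.left) ∧
          ∃ L : Fin (N - 2) → MvPolynomial (Fin (N + 1)) k, LinearIndependent k L ∧
            (∀ l, (L l).IsHomogeneous 1) ∧
              closure {i.left.base ((CartesianMonoidalCategory.fst X B).left.base z)} =
                ProjectiveSpectrum.zeroLocus (homogeneousSubmodule (Fin (N + 1)) k) (Set.range L) := by
  classical
  let P : SchemeOver k := projectiveSpace N k
  let ι := ιX B X
  let j := (i ▷ B).left
  let e₀ := iK N B X i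
  have hP := isPullback_ιX B X
  have hi := range_qgen B
  -- the line `L = closure {λ'}`, its lift `λX ∈ X_K`, the closed subvariety `V = closure {λX}`
  have ht : N - 2 ≤ N := Nat.sub_le N 2
  haveI : Infinite k := IsAlgClosed.instInfinite
  haveI : Infinite B.left.functionField :=
    Infinite.of_injective (algebraMap k B.left.functionField) (algebraMap k B.left.functionField).injective
  let lam : ↥(projectiveSpace N B.left.functionField).left := linearSubspacePoint μ hμli hμhom ht
  have hlamcl : closure {lam} = ProjectiveSpectrum.zeroLocus
      (homogeneousSubmodule (Fin (N + 1)) B.left.functionField) (Set.range μ) :=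
    closure_linearSubspacePoint μ hμli hμhom ht
  obtain ⟨lamX, hlamX⟩ : lam ∈ Set.range e₀.base :=
    hplane (linearSubspacePoint_mem_zeroLocus μ hμli hμhom ht)
  let V : ClosedSubvariety (XK B X) := ClosedSubvariety.ofPoint _ lamX
  let e : V.carrier ⟶ (projectiveSpace N B.left.functionField).left := V.ι ≫ e₀
  haveI hecl : IsClosedImmersion e := inferInstanceAs (IsClosedImmersion (V.ι ≫ iK N B X i))
  -- the same instance at the syntactic type `V ⟶ Proj K[x]` used by `RationalPointsOnLinearSubspace`
  haveI : @IsClosedImmersion _ (Proj (homogeneousSubmodule (Fin (N + 1)) B.left.functionField)) e :=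
    hecl
  have hVrange : Set.range e.base = ProjectiveSpectrum.zeroLocus
      (homogeneousSubmodule (Fin (N + 1)) B.left.functionField) (Set.range μ) := by
    rw [← hlamcl, Scheme.Hom.comp_base, TopCat.coe_comp, Set.range_comp,
      ClosedSubvariety.range_ofPoint_ι, ← e₀.isClosedEmbedding.closure_image_eq, Set.image_singleton,
      hlamX]
  -- the two lines as points `u, v` of the plane `V₊(μ)`, and their lifts `u', v' ∈ V`
  have hs1 : N - 2 + 1 ≤ N := by omega
  have hhomu : ∀ a, ((Fin.snoc μ ℓu : Fin (N - 2 + 1) → MvPolynomial (Fin (N + 1)) B.left.functionField) a).IsHomogeneous 1 :=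
    fun a => by
      refine Fin.lastCases ?_ (fun b => ?_) a
      · rw [Fin.snoc_last]; exact hℓu
      · rw [Fin.snoc_castSucc]; exact hμhom b
  have hhomv : ∀ a, ((Fin.snoc μ ℓv : Fin (N - 2 + 1) → MvPolynomial (Fin (N + 1)) B.left.functionField) a).IsHomogeneous 1 :=
    fun a => by
      refine Fin.lastCases ?_ (fun b => ?_) a
      · rw [Fin.snoc_last]; exact hℓv
      · rw [Fin.snoc_castSucc]; exact hμhom b
  let u : ↥(projectiveSpace N B.left.functionField).left := linearSubspacePoint _ hindu hhomu hs1
  let v : ↥(projectiveSpace N B.left.functionField).left := linearSubspacePoint _ hindv hhomv hs1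
  have hu : u ∈ ProjectiveSpectrum.zeroLocus
      (homogeneousSubmodule (Fin (N + 1)) B.left.functionField) (Set.range μ) := by
    rintro _ ⟨l, rfl⟩
    change μ l ∈ (ProjectiveSpectrum.asHomogeneousIdeal
      (𝒜 := homogeneousSubmodule (Fin (N + 1)) B.left.functionField) u).toIdeal
    rw [toIdeal_linearSubspacePoint]
    exact Ideal.subset_span ⟨l.castSucc, by rw [Fin.snoc_castSucc]⟩
  have hv : v ∈ ProjectiveSpectrum.zeroLocus
      (homogeneousSubmodule (Fin (N + 1)) B.left.functionField) (Set.range μ) := by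
    rintro _ ⟨l, rfl⟩
    change μ l ∈ (ProjectiveSpectrum.asHomogeneousIdeal
      (𝒜 := homogeneousSubmodule (Fin (N + 1)) B.left.functionField) v).toIdeal
    rw [toIdeal_linearSubspacePoint]
    exact Ideal.subset_span ⟨l.castSucc, by rw [Fin.snoc_castSucc]⟩
  obtain ⟨u', hu'⟩ : u ∈ Set.range e.base := by rw [hVrange]; exact hu
  obtain ⟨v', hv'⟩ : v ∈ Set.range e.base := by rw [hVrange]; exact hv
  -- instances on `V` and on `X ×ₖ B`
  haveI : LocallyOfFiniteType (e ≫ (projectiveSpace N B.left.functionField).hom) := inferInstance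
  haveI : IsLocallyNoetherian V.carrier :=
    LocallyOfFiniteType.isLocallyNoetherian (e ≫ (projectiveSpace N B.left.functionField).hom)
  haveI : LocallyOfFiniteType X.hom := by
    have h : i.left ≫ P.hom = X.hom := Over.w i
    rw [← h]
    infer_instance
  haveI : LocallyOfFiniteType (X ⊗ B).hom :=
    inferInstanceAs (LocallyOfFiniteType (pullback.fst X.hom B.hom ≫ X.hom))
  haveI : IsLocallyNoetherian (X ⊗ B).left := LocallyOfFiniteType.isLocallyNoetherian (X ⊗ B).hom
  -- the relation `[u'] - [v'] = [div g]` on the plane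
  have hu'I : (ProjectiveSpectrum.asHomogeneousIdeal
      (𝒜 := homogeneousSubmodule (Fin (N + 1)) B.left.functionField) (e.base u')).toIdeal =
        Ideal.span (Set.range
          (Fin.snoc μ ℓu : Fin (N - 2 + 1) → MvPolynomial (Fin (N + 1)) B.left.functionField)) := by
    rw [hu']
    exact toIdeal_linearSubspacePoint _ hindu hhomu hs1
  have hv'I : (ProjectiveSpectrum.asHomogeneousIdeal
      (𝒜 := homogeneousSubmodule (Fin (N + 1)) B.left.functionField) (e.base v')).toIdeal =
        Ideal.span (Set.range
          (Fin.snoc μ ℓv : Fin (N - 2 + 1) → MvPolynomial (Fin (N + 1)) B.left.functionField)) := by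
    rw [hv']
    exact toIdeal_linearSubspacePoint _ hindv hhomv hs1
  obtain ⟨g, hg0, hg⟩ := exists_eq_ord_sub_primeCycle_of_range_eq_plane (K := B.left.functionField)
    hN μ hμli hμhom e hVrange hℓu hℓv hindu hindv hu'I hv'I
  -- spread to `X ×ₖ B` (Bloch, Lemma 1A.1): the closure `S = V̄` and the lift `ḡ`
  haveI := flat_toImage hP V
  haveI := isPreimmersion_toImage hP V
  haveI : IsLocallyNoetherian (V.image ι).carrier := LocallyOfFiniteType.isLocallyNoetherian (V.image ι).ι
  obtain ⟨gbar, hgbar⟩ := (functionFieldMap_bijective_of_flat_of_isPreimmersion (V.toImage ι)).2 g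
  have hgbar0 : gbar ≠ 0 := by
    rintro rfl
    exact hg0 (by rw [← hgbar, map_zero])
  have hVdim : V.dim = (1 : ℕ) + 1 := by
    change height V.genericPoint = _
    rw [ClosedSubvariety.genericPoint_ofPoint, ← height_base_eq_of_isClosedImmersion' e₀ lamX, hlamX,
      height_linearSubspacePoint, show N - (N - 2) = 2 by omega]
    rfl
  have hdim : (V.image ι).dim = ↑(1 + 1) + 1 := by
    rw [dim_image_eq hP hi hB1 V, hVdim]
    push_cast
    ring
  let c' : AlgebraicCycle (X ⊗ B).left ℤ :=
    (V.image ι).div (ClosedSubvariety.locallyFiniteSupport_divFun_holds _) gbar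
  have hc'gen : c' ∈ ratEquivGenerators (X ⊗ B).left 2 :=
    ⟨divFun_mem_cyclesOfDim_holds (X ⊗ B) (V.image ι) hdim hgbar0 _ rfl, V.image ι, inferInstance,
      gbar, hgbar0, hdim, rfl⟩
  have hc'rat : c' ∈ ratTrivial (X ⊗ B).left 2 := AddSubgroup.subset_closure hc'gen
  have hc'dim : c' ∈ cyclesOfDim (X ⊗ B).left 2 := hc'gen.1
  -- `c' ∘ ι = [u_X] - [v_X]` with `u_X = V.ι u'`, `v_X = V.ι v'`
  have hVι_inj : Function.Injective V.ι.base := V.ι_base_injective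
  haveI : IsPreimmersion ι := MorphismProperty.of_isPullback hP.flip inferInstance
  have hι_inj : Function.Injective ι.base := ι.isEmbedding.injective
  have hkey : ∀ x, c' (ι.base x) = (primeCycle (V.ι.base u') - primeCycle (V.ι.base v')) x := by
    intro x
    change (V.image ι).divFun gbar (ι.base x) = _
    rw [divFun_image_ι_apply hP V gbar x, hgbar]
    by_cases hx : x ∈ Set.range V.ι.base
    · obtain ⟨y, rfl⟩ := hx
      rw [ClosedSubvariety.divFun_ι_base, ← hg y]
      simp only [Function.locallyFinsuppWithin.coe_sub, Pi.sub_apply]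
      rw [primeCycle_apply_of_injective' hVι_inj, primeCycle_apply_of_injective' hVι_inj]
    · rw [ClosedSubvariety.divFun_of_notMem_range _ _ hx, Function.locallyFinsuppWithin.coe_sub,
        Pi.sub_apply]
      have hxu : x ≠ V.ι.base u' := fun h => hx (h ▸ ⟨u', rfl⟩)
      have hxv : x ≠ V.ι.base v' := fun h => hx (h ▸ ⟨v', rfl⟩)
      rw [primeCycle_apply_of_ne hxu, primeCycle_apply_of_ne hxv, sub_zero]
  -- the vertical part
  refine ⟨c', hc'rat, V.ι.base u', V.ι.base v', hu'I, hv'I,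
    c' - primeCycle (ι.base (V.ι.base u')) + primeCycle (ι.base (V.ι.base v')), by abel, ?_⟩
  intro z hz
  have hsndι : ∀ x, (CartesianMonoidalCategory.snd X B).left.base (ι.base x) = genericPoint B.left := by
    intro x
    have hx : ι.base x ∈ Set.range (ιX B X).base := ⟨x, rfl⟩
    rw [range_ιX] at hx
    exact hx
  -- `z` is not over the generic point
  have hzη : (CartesianMonoidalCategory.snd X B).left.base z ≠ genericPoint B.left := by
    intro hη
    obtain ⟨x, rfl⟩ : z ∈ Set.range ι.base := by
      rw [show ι = ιX B X from rfl, range_ιX]; exact hη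
    apply hz
    simp only [Function.locallyFinsuppWithin.coe_add, Function.locallyFinsuppWithin.coe_sub,
      Pi.add_apply, Pi.sub_apply, hkey x, primeCycle_apply_of_injective' hι_inj]
    ring
  have hzu : primeCycle (ι.base (V.ι.base u')) z = 0 :=
    primeCycle_apply_of_ne fun h => hzη (by rw [h]; exact hsndι _)
  have hzv : primeCycle (ι.base (V.ι.base v')) z = 0 :=
    primeCycle_apply_of_ne fun h => hzη (by rw [h]; exact hsndι _)
  have hcz : c' z ≠ 0 := by
    have hcz' : (c' - primeCycle (ι.base (V.ι.base u')) + primeCycle (ι.base (V.ι.base v'))) z =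
        c' z := by
      simp only [Function.locallyFinsuppWithin.coe_add, Function.locallyFinsuppWithin.coe_sub,
        Pi.add_apply, Pi.sub_apply, hzu, hzv]
      ring
    rwa [hcz'] at hz
  have hheight : height z = 2 := hc'dim z hcz
  -- `pr₂ z` is a closed point
  have hclosed : IsClosed ({(CartesianMonoidalCategory.snd X B).left.base z} : Set B.left) :=
    isClosed_singleton_of_ne_genericPoint hB1 hzη
  -- `z` lies in the closure of `ι λX`, so `w = (i × B) z` lies in the closure of `ι_ℙ λ'`
  have hzS : z ∈ closure {ι.base lamX} := by
    have hzr : z ∈ Set.range (V.image ι).ι.base := by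
      by_contra hnot
      exact hcz (ClosedSubvariety.divFun_of_notMem_range _ _ hnot)
    rw [ClosedSubvariety.range_ι_eq_closure, ClosedSubvariety.genericPoint_image,
      ClosedSubvariety.genericPoint_ofPoint] at hzr
    exact hzr
  have hjι : ∀ x, j.base (ι.base x) = (genericFibreι N B).base (e₀.base x) := by
    intro x
    change ((ιX B X ≫ (i ▷ B).left).base x) = ((iK N B X i ≫ genericFibreι N B).base x)
    rw [iK_genericFibreι]
  have hwS : j.base z ∈ closure {(genericFibreι N B).base lam} := by
    have h := image_closure_subset_closure_image j.base.hom.continuous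
      (s := {ι.base lamX}) ⟨z, hzS, rfl⟩
    rw [Set.image_singleton, hjι, hlamX] at h
    exact h
  have hwheight : height (j.base z) = ((N - (N - 2) : ℕ) : ℕ∞) := by
    rw [height_base_eq_of_isClosedImmersion' j z, hheight, show N - (N - 2) = 2 by omega]
    rfl
  have hwsnd : (CartesianMonoidalCategory.snd P B).left.base (j.base z) =
      (CartesianMonoidalCategory.snd X B).left.base z := by
    change (((i ▷ B).left ≫ (CartesianMonoidalCategory.snd P B).left).base z) = _
    rw [whiskerRight_left_snd]
  have hwfst : (CartesianMonoidalCategory.fst P B).left.base (j.base z) =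
      i.left.base ((CartesianMonoidalCategory.fst X B).left.base z) := by
    change (((i ▷ B).left ≫ (CartesianMonoidalCategory.fst P B).left).base z) = _
    rw [whiskerRight_left_fst]
    rfl
  -- limits of planes are planes
  obtain ⟨L, hLli, hLhom, hcl⟩ := exists_linearSubspace_of_vertical ht B (genericFibreι N B)
    (genericFibreι_fst N B) (genericFibreι_snd N B) μ hμli hμhom lam
    (fun l => linearSubspacePoint_mem_zeroLocus μ hμli hμhom ht ⟨l, rfl⟩)
    hwS hwheight hclosed hwsnd (hpid _ hclosed)
  refine ⟨hheight, hclosed, L, hLli, hLhom, ?_⟩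
  rw [← hwfst]
  exact hcl


omit [IsAlgClosed k] in
/-- **The line-family relation over a two-dimensional base.** As `exists_relation_of_two_points_on_line`
(`Motives/RuledSurfaceRelation`), but for an integral base `B` whose generic point has dimension `2`
(the product-trick for `2`-cycles runs over a surface): for a `K`-line `V₊(μ) ⊆ X_K` and two closed
points `u, v` on it of the same degree there are `c' ∈ Rat₂(X ×ₖ B)` (`[div ḡ]` on the closure of
the line, a threefold), lifts `u_X, v_X ∈ X_K`, the lift `λ_X` of the generic point of the line, and
`vert` with `c' = [ι u_X] - [ι v_X] + vert`, where every `z` with `vert z ≠ 0` has dimension `2`,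
does NOT lie over the generic point of `B`, and lies in the closure of `ι λ_X` (the threefold swept
by the family of lines); the identification of these vertical components (over curves of `B`) is
left to the user. [cite: TianZong2014, proofs of Prop. 3.1 and Prop. 7.2] [cite: BlochLectures2010, Lemma 1A.1] -/
theorem exists_relation_of_two_points_on_line_surfaceBase (hN : 1 ≤ N)
    (hB2 : height (genericPoint B.left) = 2)
    (μ : Fin (N - 1) → MvPolynomial (Fin (N + 1)) B.left.functionField)
    (hμli : LinearIndependent B.left.functionField μ) (hμhom : ∀ l, (μ l).IsHomogeneous 1)
    (hline : ProjectiveSpectrum.zeroLocus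
      (homogeneousSubmodule (Fin (N + 1)) B.left.functionField) (Set.range μ) ⊆
        Set.range (iK N B X i).base)
    {u v : ↥(projectiveSpace N B.left.functionField).left}
    (hu : u ∈ ProjectiveSpectrum.zeroLocus
      (homogeneousSubmodule (Fin (N + 1)) B.left.functionField) (Set.range μ))
    (hv : v ∈ ProjectiveSpectrum.zeroLocus
      (homogeneousSubmodule (Fin (N + 1)) B.left.functionField) (Set.range μ))
    (hu0 : height u = 0) (hv0 : height v = 0)
    (hdeg : (projectiveSpace N B.left.functionField).hom.residueDegree u =
      (projectiveSpace N B.left.functionField).hom.residueDegree v) :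
    ∃ c' ∈ ratTrivial (X ⊗ B).left 2, ∃ uX vX lamX : ↥(XK B X),
      (iK N B X i).base uX = u ∧ (iK N B X i).base vX = v ∧
      (iK N B X i).base lamX = linearSubspacePoint μ hμli hμhom (Nat.sub_le N 1) ∧
      ∃ vert : AlgebraicCycle (X ⊗ B).left ℤ,
        c' = primeCycle ((ιX B X).base uX) - primeCycle ((ιX B X).base vX) + vert ∧
        ∀ z, vert z ≠ 0 → height z = 2 ∧
          (CartesianMonoidalCategory.snd X B).left.base z ≠ genericPoint B.left ∧
          z ∈ closure {(ιX B X).base lamX} := by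
  classical
  let P : SchemeOver k := projectiveSpace N k
  let ι := ιX B X
  let j := (i ▷ B).left
  let e₀ := iK N B X i
  have hP := isPullback_ιX B X
  have hi := range_qgen B
  -- the line `L = closure {λ'}`, its lift `λX ∈ X_K`, the closed subvariety `V = closure {λX}`
  have ht : N - 1 ≤ N := Nat.sub_le N 1
  let lam : ↥(projectiveSpace N B.left.functionField).left := linearSubspacePoint μ hμli hμhom ht
  have hlamcl : closure {lam} = ProjectiveSpectrum.zeroLocus
      (homogeneousSubmodule (Fin (N + 1)) B.left.functionField) (Set.range μ) :=
    closure_linearSubspacePoint μ hμli hμhom ht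
  obtain ⟨lamX, hlamX⟩ : lam ∈ Set.range e₀.base :=
    hline (linearSubspacePoint_mem_zeroLocus μ hμli hμhom ht)
  let V : ClosedSubvariety (XK B X) := ClosedSubvariety.ofPoint _ lamX
  let e : V.carrier ⟶ (projectiveSpace N B.left.functionField).left := V.ι ≫ e₀
  haveI hecl : IsClosedImmersion e := inferInstanceAs (IsClosedImmersion (V.ι ≫ iK N B X i))
  -- the same instance at the syntactic type `V ⟶ Proj K[x]` used by `RationalPointsOnLinearSubspace`
  haveI : @IsClosedImmersion _ (Proj (homogeneousSubmodule (Fin (N + 1)) B.left.functionField)) e :=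
    hecl
  have hVrange : Set.range e.base = ProjectiveSpectrum.zeroLocus
      (homogeneousSubmodule (Fin (N + 1)) B.left.functionField) (Set.range μ) := by
    rw [← hlamcl, Scheme.Hom.comp_base, TopCat.coe_comp, Set.range_comp,
      ClosedSubvariety.range_ofPoint_ι, ← e₀.isClosedEmbedding.closure_image_eq, Set.image_singleton,
      hlamX]
  obtain ⟨u', hu'⟩ : u ∈ Set.range e.base := by rw [hVrange]; exact hu
  obtain ⟨v', hv'⟩ : v ∈ Set.range e.base := by rw [hVrange]; exact hv
  -- instances on `V` and on `X ×ₖ B`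
  haveI : LocallyOfFiniteType (e ≫ (projectiveSpace N B.left.functionField).hom) := inferInstance
  haveI : IsLocallyNoetherian V.carrier :=
    LocallyOfFiniteType.isLocallyNoetherian (e ≫ (projectiveSpace N B.left.functionField).hom)
  haveI : LocallyOfFiniteType X.hom := by
    have h : i.left ≫ P.hom = X.hom := Over.w i
    rw [← h]
    infer_instance
  haveI : LocallyOfFiniteType (X ⊗ B).hom :=
    inferInstanceAs (LocallyOfFiniteType (pullback.fst X.hom B.hom ≫ X.hom))
  haveI : IsLocallyNoetherian (X ⊗ B).left := LocallyOfFiniteType.isLocallyNoetherian (X ⊗ B).hom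
  -- the relation `[u'] - [v'] = [div g]` on the line
  have hu'0 : height u' = 0 := by rw [← height_base_eq_of_isClosedImmersion' e u', hu', hu0]
  have hv'0 : height v' = 0 := by rw [← height_base_eq_of_isClosedImmersion' e v', hv', hv0]
  obtain ⟨g, hg0, hg⟩ := exists_eq_ord_sub_primeCycle_of_range_eq_line (k := B.left.functionField)
    hN μ hμli hμhom e hVrange hu'0 hv'0 (by rw [← hu', ← hv'] at hdeg; exact hdeg)
  -- spread to `X ×ₖ B` (Bloch, Lemma 1A.1): the closure `S = V̄` and the lift `ḡ`
  haveI := flat_toImage hP V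
  haveI := isPreimmersion_toImage hP V
  haveI : IsLocallyNoetherian (V.image ι).carrier := LocallyOfFiniteType.isLocallyNoetherian (V.image ι).ι
  obtain ⟨gbar, hgbar⟩ := (functionFieldMap_bijective_of_flat_of_isPreimmersion (V.toImage ι)).2 g
  have hgbar0 : gbar ≠ 0 := by
    rintro rfl
    exact hg0 (by rw [← hgbar, map_zero])
  have hVdim : V.dim = (0 : ℕ) + 1 := by
    change height V.genericPoint = _
    rw [ClosedSubvariety.genericPoint_ofPoint, ← height_base_eq_of_isClosedImmersion' e₀ lamX, hlamX,
      height_linearSubspacePoint, show N - (N - 1) = 1 by omega]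
    rfl
  have hdim : (V.image ι).dim = ↑(1 + 1) + 1 := by
    rw [dim_image_eq hP hi hB2 V, hVdim]
    push_cast
    ring
  let c' : AlgebraicCycle (X ⊗ B).left ℤ :=
    (V.image ι).div (ClosedSubvariety.locallyFiniteSupport_divFun_holds _) gbar
  have hc'gen : c' ∈ ratEquivGenerators (X ⊗ B).left 2 :=
    ⟨divFun_mem_cyclesOfDim_holds (X ⊗ B) (V.image ι) hdim hgbar0 _ rfl, V.image ι, inferInstance,
      gbar, hgbar0, hdim, rfl⟩
  have hc'rat : c' ∈ ratTrivial (X ⊗ B).left 2 := AddSubgroup.subset_closure hc'gen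
  have hc'dim : c' ∈ cyclesOfDim (X ⊗ B).left 2 := hc'gen.1
  -- `c' ∘ ι = [u_X] - [v_X]` with `u_X = V.ι u'`, `v_X = V.ι v'`
  have hVι_inj : Function.Injective V.ι.base := V.ι_base_injective
  haveI : IsPreimmersion ι := MorphismProperty.of_isPullback hP.flip inferInstance
  have hι_inj : Function.Injective ι.base := ι.isEmbedding.injective
  have hkey : ∀ x, c' (ι.base x) = (primeCycle (V.ι.base u') - primeCycle (V.ι.base v')) x := by
    intro x
    change (V.image ι).divFun gbar (ι.base x) = _
    rw [divFun_image_ι_apply hP V gbar x, hgbar]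
    by_cases hx : x ∈ Set.range V.ι.base
    · obtain ⟨y, rfl⟩ := hx
      rw [ClosedSubvariety.divFun_ι_base, ← hg y]
      simp only [Function.locallyFinsuppWithin.coe_sub, Pi.sub_apply]
      rw [primeCycle_apply_of_injective' hVι_inj, primeCycle_apply_of_injective' hVι_inj]
    · rw [ClosedSubvariety.divFun_of_notMem_range _ _ hx, Function.locallyFinsuppWithin.coe_sub,
        Pi.sub_apply]
      have hxu : x ≠ V.ι.base u' := fun h => hx (h ▸ ⟨u', rfl⟩)
      have hxv : x ≠ V.ι.base v' := fun h => hx (h ▸ ⟨v', rfl⟩)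
      rw [primeCycle_apply_of_ne hxu, primeCycle_apply_of_ne hxv, sub_zero]
  -- the vertical part
  refine ⟨c', hc'rat, V.ι.base u', V.ι.base v', lamX, hu', hv', hlamX,
    c' - primeCycle (ι.base (V.ι.base u')) + primeCycle (ι.base (V.ι.base v')), by abel, ?_⟩
  intro z hz
  have hsndι : ∀ x, (CartesianMonoidalCategory.snd X B).left.base (ι.base x) = genericPoint B.left := by
    intro x
    have hx : ι.base x ∈ Set.range (ιX B X).base := ⟨x, rfl⟩
    rw [range_ιX] at hx
    exact hx
  -- `z` is not over the generic point
  have hzη : (CartesianMonoidalCategory.snd X B).left.base z ≠ genericPoint B.left := by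
    intro hη
    obtain ⟨x, rfl⟩ : z ∈ Set.range ι.base := by
      rw [show ι = ιX B X from rfl, range_ιX]; exact hη
    apply hz
    simp only [Function.locallyFinsuppWithin.coe_add, Function.locallyFinsuppWithin.coe_sub,
      Pi.add_apply, Pi.sub_apply, hkey x, primeCycle_apply_of_injective' hι_inj]
    ring
  have hzu : primeCycle (ι.base (V.ι.base u')) z = 0 :=
    primeCycle_apply_of_ne fun h => hzη (by rw [h]; exact hsndι _)
  have hzv : primeCycle (ι.base (V.ι.base v')) z = 0 :=
    primeCycle_apply_of_ne fun h => hzη (by rw [h]; exact hsndι _)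
  have hcz : c' z ≠ 0 := by
    have hcz' : (c' - primeCycle (ι.base (V.ι.base u')) + primeCycle (ι.base (V.ι.base v'))) z =
        c' z := by
      simp only [Function.locallyFinsuppWithin.coe_add, Function.locallyFinsuppWithin.coe_sub,
        Pi.add_apply, Pi.sub_apply, hzu, hzv]
      ring
    rwa [hcz'] at hz
  have hheight : height z = 2 := hc'dim z hcz
  -- `z` lies in the closure of `ι λX`, so `w = (i × B) z` lies in the closure of `ι_ℙ λ'`
  have hzS : z ∈ closure {ι.base lamX} := by
    have hzr : z ∈ Set.range (V.image ι).ι.base := by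
      by_contra hnot
      exact hcz (ClosedSubvariety.divFun_of_notMem_range _ _ hnot)
    rw [ClosedSubvariety.range_ι_eq_closure, ClosedSubvariety.genericPoint_image,
      ClosedSubvariety.genericPoint_ofPoint] at hzr
    exact hzr
  exact ⟨hheight, hzη, hzS⟩

end Relation

end ProjFamily

end Literature.AlgebraicGeometry.Motives

end
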